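import Literature.Computability.Complexity.AverageCaseDepthHierarchyProcess
import Literature.Computability.Complexity.AverageCaseDepthHierarchyProofs
import HarnessLib

/-!
# The parameters of the Rossman–Servedio–Tan process (§6–§7) as a `ProcParams`

B. Rossman, R. A. Servedio, L.-Y. Tan, *An average-case depth hierarchy theorem for Boolean
circuits*, arXiv:1504.03398 [RossmanServedioTan2015], §6 (p. 15: `w, p, w₀`, the fan-ins of
`Sipser_d`), §7.1 (p. 16: `λ, q, t_{d-1}, …, t_1`, eq. (11)–(12)), §7.2 Definitions 6, 8, 9 and 10
(pp. 16–18: `R_init`, `k`-acceptable sets with `β(k,d) = 1/3 + (d-k-1)/(12d)`, `R(τ)`, `Ψ`).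

This file only ASSEMBLES the data: the process `rstProc m d : ProcParams` whose stage `j`
(`j = d-1, …, 1`, restricting the level-`(j+1)` variables, blocks = depth-`j` gates) uses the block
law with polarity `altPol (bodd d) j` (root `∧` iff `d` odd, so that the bottom gates are `∧`),
`t = T (j+1)`, `t' = T j` where `T k = t_k` (`rstT m d k`) for `1 ≤ k ≤ d-1` and `T d = 1/2`
(so that stage `d-1` is `R_init`: `τ = ⋆`, `t = 1/2`, `q_a(m) = (p - λ)/t_{d-1} = q`), `λ = rstLam m`,
and acceptability `|n - q w| ≤ Δ_j` with `Δ_j = w^{1/3 + (d-2-j)/(12d)}` (RST's `β(j+1, d)`) at the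
stages `j ≤ d-2` and `n = m` at the top stage. `rstProc_consistent` checks the consistency
conditions of `ProcParams.Consistent` from the sign conditions `0 < t_k < 1`, `λ < p` (which the
sibling asymptotics file derives from Lemma 7.1 in the regime `d ≤ c m / log m`).
Nothing is estimated here.
-/

noncomputable section

namespace Literature.Computability.Complexity

namespace RSTProj

open Finset

/-- `T k`: `t_k` for `1 ≤ k ≤ d-1` and `t_d := 1/2` (the star probability of `R_init`, Def. 6:
`{⋆_{1/2}, 1_{1/2}}^m`). [cite: RossmanServedioTan2015, §7.1 eq. (11) (p. 16) and §7.2 Def. 6 (p. 16)] -/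
def rstTk (m d k : ℕ) : ℝ := if k = d then 1 / 2 else rstT m d k

/-- The acceptability radius `Δ_j = w^{β(j+1,d)}`, `β(k,d) = 1/3 + (d-k-1)/(12d)`, for the blocks
met at stage `j` (children of depth-`j` gates). [cite: RossmanServedioTan2015, §7.2 Def. 8 (p. 17)] -/
def rstDelta (m d j : ℕ) : ℝ := (rstW m : ℝ) ^ ((1 : ℝ) / 3 + ((d : ℝ) - 2 - j) / (12 * d))

/-- Acceptability of a block size at stage `j`: `|n - q w| ≤ Δ_j` (RST: `|S| = qw ± w^{β}`) below the
top, `n = m` at the top stage `j = d-1` (every block of `R_init` has exactly `m` stars); nothing is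
acceptable at the unused indices `j ≥ d` (so that those laws are trivially well-behaved).
[cite: RossmanServedioTan2015, §7.2 Def. 8 (p. 17) and Def. 6 (p. 16)] -/
def rstAcc (m d j : ℕ) (n : ℕ) : Bool :=
  if d ≤ j then false else if j + 1 = d then decide (n = m) else decide (|(n : ℝ) - rstQ m * rstW m| ≤ rstDelta m d j)

/-- The block law of stage `j` of RST's process. [cite: RossmanServedioTan2015, §7.2 Defs. 6, 9 (pp. 16–18)] -/
def rstLaw (m d j : ℕ) : BlockLaw where
  o := altPol (Nat.bodd d) j
  t := rstTk m d (j + 1)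
  t' := rstTk m d j
  lam := rstLam m
  acc := rstAcc m d j

/-- **RST's process** `Ψ` with its parameters: fan-ins `rstWseq m d = (w₀, w, …, w, m)` and the stage
laws `rstLaw m d`. [cite: RossmanServedioTan2015, §7.2 Def. 10 (p. 18)] -/
def rstProc (m d : ℕ) : ProcParams where
  W := rstWseq m d
  law := rstLaw m d

/-- The polarities of RST's process are the alternating ones of `balancedSipser`. [cite: RossmanServedioTan2015, §6 (p. 15)] -/
theorem rstProc_o (m d j : ℕ) : ((rstProc m d).law j).o = altPol (Nat.bodd d) j := rfl

/-- Alternation of `altPol`. [folklore] -/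
theorem altPol_succ_apply (b : Bool) (j : ℕ) : altPol b (j + 1) = !altPol b j := by
  have := congrFun (altPol_succ b) j
  rw [this]
  unfold altPol
  split_ifs <;> simp

/-- `T k` for `k > d` is `t_{d-1}`'s formula `(p - λ)/q` (junk index: `rstT m d k = rstTAux m 0`). [folklore] -/
theorem rstTk_of_gt {m d k : ℕ} (hk : d < k) : rstTk m d k = (rstP m - rstLam m) / rstQ m := by
  unfold rstTk rstT
  rw [if_neg (by omega), show d - 1 - k = 0 by omega]
  rfl

/-- **Consistency of RST's parameters** (the hypotheses of the completion to uniform): given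
`0 < t_k < 1` for `1 ≤ k ≤ d-1` and `λ < p ≤ 1/2·q`-type sign conditions, `rstProc m d` is
consistent. [cite: RossmanServedioTan2015, §7.1 (p. 16, the choice of `t_{d-1}, …, t_1`) and Lemma 7.1] -/
theorem rstProc_consistent {m d : ℕ} (hd : 2 ≤ d)
    (hT : ∀ k, 1 ≤ k → k ≤ d - 1 → 0 < rstT m d k ∧ rstT m d k < 1)
    (hlam : rstLam m < rstP m) (hpq : rstP m < rstQ m) : (rstProc m d).Consistent := by
  have hq := rstQ_pos m
  -- the extended sequence `T` is in `(0, 1)` at every index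
  have hTk : ∀ k, 1 ≤ k → 0 < rstTk m d k ∧ rstTk m d k < 1 := by
    intro k hk
    by_cases hkd : k = d
    · subst hkd; unfold rstTk; rw [if_pos rfl]; norm_num
    by_cases hlt : k < d
    · unfold rstTk; rw [if_neg hkd]; exact hT k hk (by omega)
    · rw [rstTk_of_gt (by omega)]
      refine ⟨div_pos (by linarith) hq, ?_⟩
      rw [div_lt_one hq]
      linarith [rstLam_nonneg m]
  refine ⟨fun j => altPol_succ_apply _ j, fun j => rfl, fun j => (hTk (j + 1) (by omega)).1,
    fun j => (hTk (j + 1) (by omega)).2.le, fun j => (hTk (j + 1) (by omega)).1.ne'⟩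

/-- The top stage of RST's process is `R_init`: `t = 1/2`. [cite: RossmanServedioTan2015, §7.2 Def. 6 (p. 16)] -/
theorem rstProc_t_top {m d : ℕ} (hd : 1 ≤ d) : ((rstProc m d).law (d - 1)).t = 1 / 2 := by
  show rstTk m d (d - 1 + 1) = 1 / 2
  unfold rstTk; rw [if_pos (by omega)]

/-- At the top stage `q_a(m) = q` exactly (`(1/2)^m = p`, `t_{d-1} = (p - λ)/q`). [cite: RossmanServedioTan2015, §7.1 eq. (11) (p. 16)] -/
theorem qa_top {m d : ℕ} (hd : 2 ≤ d) (hlam : rstLam m < rstP m) : ((rstProc m d).law (d - 1)).qa m = rstQ m := by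
  have hq := rstQ_pos m
  show ((1 - rstTk m d (d - 1 + 1)) ^ m - rstLam m) / rstTk m d (d - 1) = rstQ m
  have e1 : rstTk m d (d - 1 + 1) = 1 / 2 := by unfold rstTk; rw [if_pos (by omega)]
  have e2 : rstTk m d (d - 1) = (rstP m - rstLam m) / rstQ m := by
    unfold rstTk rstT; rw [if_neg (by omega), show d - 1 - (d - 1) = 0 by omega]; rfl
  have e3 : ((1 : ℝ) - 1 / 2) ^ m = rstP m := by
    rw [show (1 : ℝ) - 1 / 2 = 2⁻¹ by norm_num, inv_pow, ← Real.rpow_natCast, ← Real.rpow_neg two_pos.le]; rfl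
  rw [e1, e2, e3, div_div_eq_mul_div, div_eq_iff (by linarith), mul_comm]

end RSTProj

end Literature.Computability.Complexity

end
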